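import Mathlib
import HarnessLib
import Summits.Ventures.LatticeQCDFlow.Exactness.PseudoMarginalFlowSampler
import Summits.Ventures.LatticeQCDFlow.Exactness.IMHMultiProposalStickingFloor

/-!
# The pseudo-marginal flow sampler's stickiness, quantified: an `M`-fold OVERESTIMATE of the weight is left with probability at most
# `Z/ŵ` per step (so it is held for `≳ M·w(x)/Z` steps), and at stationarity the chain spends a fraction at most `(∫ w dq + ∫ Var_κŵ/w dq)/M`
# of its time at such overestimates

HONEST FRAMING: exact (Metropolis-corrected) sampling algorithms for lattice gauge theory;
figures of merit are autocorrelation/cost numbers at stated couplings and volumes; no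
continuum-physics claim.

Venture `LatticeQCDFlow` (cell pub-lqcd), topic `Exactness`; FANOUT row 30 (lean-1, GEN-42).  NEW WORK of the cell, sequel of this generation's
`PseudoMarginalFlowSampler`, over the tree's `IMHKernel` (`indepMH_apply_le_imhAcceptMass`, `imhAcceptMass_le`: from `z` the chain moves with
probability at most `ŵ(z)⁻¹∫ŵ`) and `IMHMultiProposalStickingFloor.iterate_bind_apply_self_ge` (a holding floor iterates).  The well-known
practical pathology of pseudo-marginal chains — a lucky large estimate freezes the chain — in the flow sampler's vocabulary, with the stationary
time-fraction it costs.  Nothing is cited as a fact.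

## Setting
`q` flow law, `κ` noise kernel, `ŵ > 0` measurable estimate unbiased for `w > 0` (`∫ ŵ(x, u) κ_x(du) = w(x)`), `Z = ∫ w dq` (`= 1` when
normalised), extended target `π̂ = ŵ·(q ⊗ₘ κ)`, run `K̂ = indepMH (q ⊗ₘ κ) ŵ`; the OVERESTIMATE REGION `S_M = {(x, u) | ŵ(x, u) > M·w(x)}`.

## Results (no `sorry`, no new definitions)
* `pseudoMarginal_lintegral_estimate` — `∫ ŵ d(q ⊗ₘ κ) = ∫ w dq` (`= Z`).
* **`pseudoMarginal_leave_le`** — from `z = (x, u)` the run LEAVES `z` with probability at most `Z/ŵ(x, u)` (any measurable `B ∌ z`: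
  `K̂(z, B) ≤ Z/ŵ(z)`); **`pseudoMarginal_hold_ge`** — `K̂(z, {z}) ≥ 1 − Z/ŵ(z)`, and **`pseudoMarginal_sojourn_ge`** — `(δ_z K̂ᵗ)({z}) ≥ (1 − Z/ŵ(z))ᵗ`:
  an estimate `ŵ(z) = M·w(x)` at a typical configuration (`w(x) ≈ Z`) pins the chain for `≳ M` steps.
* `measurableSet_overestimate`, **`pseudoMarginal_overestimate_mass_eq`** — `π̂(S_M) = ∫∫ 1{ŵ > Mw} ŵ dκ dq` (the SIZE-BIASED tail of the estimator:
  the stationary time fraction spent at `M`-fold overestimates); **`pseudoMarginal_overestimate_mass_le`** — `π̂(S_M) ≤ M⁻¹·∫ E_κ[ŵ(x,·)²]/w(x) q(dx)`,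
  and with the variance identity of `PseudoMarginalFlowSampler` (`E_κ[ŵ²] = w² + Var_κ ŵ`): **`pseudoMarginal_overestimate_mass_le_var`** —
  `π̂(S_M) ≤ M⁻¹·∫ (w(x) + v(x)/w(x)) q(dx)` for any measurable version `v` of the conditional variance: the RELATIVE noise `Var_κŵ/w²`, weighted
  by `π`, is what buys time in the frozen region.
* **`pseudoMarginal_no_uniform_rate`** — if the estimator is UNBOUNDED (`∀ M, ∃ z, ŵ(z) ≥ M`; Gaussian pseudofermion estimates are) then for
  every `t`, `η > 0` some start has `(δ_zK̂ᵗ)({z}) ≥ 1 − η`: no every-start geometric rate exists — the noisy sampler is not uniformly ergodic.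
* `min_one_sub_abs_le`, **`pseudoMarginal_integral_min_one_ge`** — the other direction of `PseudoMarginalFlowSampler`'s `ĉ₁ ≤ c₁`:
  `ĉ₁ ≥ c₁ − E_{q⊗κ}|ŵ − w|` — the noise costs at most the estimator's mean absolute deviation in `c₁`.
Reading (gauge files with fermions): a stochastic determinant estimate that overshoots by a factor `M` freezes the exact flow sampler for about `M`
updates; at stationarity such episodes occupy at most `(1 + ⟨Var(est)/det²⟩_π)/M` of the run — reduce the estimator's relative variance (more
pseudofermion draws, `PseudoMarginalAveragingLaw`) where `π` lives, not where `q` proposes.  NOT CLAIMED: lower bounds on the time fraction;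
anything about underestimates (they are harmless for sticking and are what `ĉ₁ ≤ c₁` records).
-/

noncomputable section

namespace Summit.Ventures.LatticeQCDFlow.Exactness

open MeasureTheory ProbabilityTheory
open scoped ENNReal

variable {Ω U : Type*} [MeasurableSpace Ω] [MeasurableSpace U]
  {q : Measure Ω} [IsProbabilityMeasure q] {κ : Kernel Ω U} [IsMarkovKernel κ]
  {w : Ω → ℝ} {west : Ω × U → ℝ}

/-- `∫ ŵ d(q ⊗ₘ κ) = ∫ w dq`: the estimator and the weight have the same normaliser. [ours, bookkeeping] -/
theorem pseudoMarginal_lintegral_estimate (hW : Measurable west)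
    (hunb : ∀ x, ∫⁻ u, ENNReal.ofReal (west (x, u)) ∂(κ x) = ENNReal.ofReal (w x)) :
    ∫⁻ z, ENNReal.ofReal (west z) ∂(q ⊗ₘ κ) = ∫⁻ x, ENNReal.ofReal (w x) ∂q := by
  rw [Measure.lintegral_compProd hW.ennreal_ofReal]
  exact lintegral_congr fun x => hunb x

/-- **LEAVING AN OVERESTIMATE IS UNLIKELY**: from `z` the pseudo-marginal run enters any measurable `B ∌ z` with probability at most
`ŵ(z)⁻¹·∫ w dq` (`= Z/ŵ(z)`). [ours — `IMHKernel` on `Ω × U`] -/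
theorem pseudoMarginal_leave_le (hW : Measurable west) (hW0 : ∀ z, 0 < west z)
    (hunb : ∀ x, ∫⁻ u, ENNReal.ofReal (west (x, u)) ∂(κ x) = ENNReal.ofReal (w x)) {z : Ω × U} {B : Set (Ω × U)}
    (hB : MeasurableSet B) (hz : z ∉ B) :
    indepMH (q ⊗ₘ κ) west z B ≤ (ENNReal.ofReal (west z))⁻¹ * ∫⁻ x, ENNReal.ofReal (w x) ∂q := by
  calc indepMH (q ⊗ₘ κ) west z B ≤ imhAcceptMass (q ⊗ₘ κ) west z := indepMH_apply_le_imhAcceptMass hW hB hz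
    _ ≤ ENNReal.ofReal (west z)⁻¹ * ∫⁻ z', ENNReal.ofReal (west z') ∂(q ⊗ₘ κ) := imhAcceptMass_le hW0 z
    _ = (ENNReal.ofReal (west z))⁻¹ * ∫⁻ x, ENNReal.ofReal (w x) ∂q := by
        rw [pseudoMarginal_lintegral_estimate hW hunb, ENNReal.ofReal_inv_of_pos (hW0 z)]

/-- **… SO THE CHAIN HOLDS**: `K̂(z, {z}) ≥ 1 − Z/ŵ(z)`. [ours] -/
theorem pseudoMarginal_hold_ge [MeasurableSingletonClass (Ω × U)] (hW : Measurable west) (hW0 : ∀ z, 0 < west z)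
    (hunb : ∀ x, ∫⁻ u, ENNReal.ofReal (west (x, u)) ∂(κ x) = ENNReal.ofReal (w x)) (z : Ω × U) :
    haveI : Fact (Measurable west) := ⟨hW⟩
    1 - (ENNReal.ofReal (west z))⁻¹ * ∫⁻ x, ENNReal.ofReal (w x) ∂q ≤ indepMH (q ⊗ₘ κ) west z {z} := by
  haveI : Fact (Measurable west) := ⟨hW⟩
  have hc : indepMH (q ⊗ₘ κ) west z {z}ᶜ ≤ (ENNReal.ofReal (west z))⁻¹ * ∫⁻ x, ENNReal.ofReal (w x) ∂q :=
    pseudoMarginal_leave_le hW hW0 hunb (measurableSet_singleton z).compl (fun h => h rfl)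
  have h1 : indepMH (q ⊗ₘ κ) west z {z} = 1 - indepMH (q ⊗ₘ κ) west z {z}ᶜ := by
    rw [← prob_compl_eq_one_sub (measurableSet_singleton z).compl, compl_compl]
  rw [h1]
  exact tsub_le_tsub_left hc 1

/-- **THE SOJOURN**: `(δ_z K̂ᵗ)({z}) ≥ (1 − Z/ŵ(z))ᵗ` — an `M`-fold overestimate at a configuration with `w(x) = Z` survives `t` updates with
probability at least `(1 − 1/M)ᵗ`. [ours] -/
theorem pseudoMarginal_sojourn_ge [MeasurableSingletonClass (Ω × U)] (hW : Measurable west) (hW0 : ∀ z, 0 < west z)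
    (hunb : ∀ x, ∫⁻ u, ENNReal.ofReal (west (x, u)) ∂(κ x) = ENNReal.ofReal (w x)) (z : Ω × U) (t : ℕ) :
    haveI : Fact (Measurable west) := ⟨hW⟩
    (1 - (ENNReal.ofReal (west z))⁻¹ * ∫⁻ x, ENNReal.ofReal (w x) ∂q) ^ t ≤
      ((fun μ : Measure (Ω × U) => μ.bind (indepMH (q ⊗ₘ κ) west))^[t] (Measure.dirac z)) {z} :=
  haveI : Fact (Measurable west) := ⟨hW⟩
  iterate_bind_apply_self_ge _ (pseudoMarginal_hold_ge hW hW0 hunb z) t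

/-- The overestimate region `S_M = {ŵ > M·w}` is measurable. [ours, bookkeeping] -/
theorem measurableSet_overestimate (hW : Measurable west) (hw : Measurable w) (M : ℝ) :
    MeasurableSet {z : Ω × U | M * w z.1 < west z} :=
  measurableSet_lt ((hw.comp measurable_fst).const_mul M) hW

/-- **THE STATIONARY TIME FRACTION AT OVERESTIMATES IS THE SIZE-BIASED TAIL**: `π̂(S_M) = ∫∫ 1{ŵ > Mw} ŵ dκ_x dq`. [ours] -/
theorem pseudoMarginal_overestimate_mass_eq (hW : Measurable west) (hw : Measurable w) (M : ℝ) :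
    ((q ⊗ₘ κ).withDensity fun z => ENNReal.ofReal (west z)) {z : Ω × U | M * w z.1 < west z} =
      ∫⁻ x, ∫⁻ u, {z : Ω × U | M * w z.1 < west z}.indicator (fun z => ENNReal.ofReal (west z)) (x, u) ∂(κ x) ∂q := by
  rw [withDensity_apply _ (measurableSet_overestimate hW hw M), ← lintegral_indicator (measurableSet_overestimate hW hw M),
    Measure.lintegral_compProd (hW.ennreal_ofReal.indicator (measurableSet_overestimate hW hw M))]

/-- **… AND IS AT MOST `M⁻¹·∫ E_κ[ŵ(x, ·)²]/w(x) q(dx)`** (on `S_M`, `ŵ < ŵ²/(Mw)`). [ours] -/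
theorem pseudoMarginal_overestimate_mass_le (hW : Measurable west) (hw : Measurable w) (hw0 : ∀ x, 0 < w x) {M : ℝ} (hM : 0 < M) :
    ((q ⊗ₘ κ).withDensity fun z => ENNReal.ofReal (west z)) {z : Ω × U | M * w z.1 < west z} ≤
      (ENNReal.ofReal M)⁻¹ * ∫⁻ x, (ENNReal.ofReal (w x))⁻¹ * ∫⁻ u, ENNReal.ofReal (west (x, u) ^ 2) ∂(κ x) ∂q := by
  rw [pseudoMarginal_overestimate_mass_eq hW hw M, ← lintegral_const_mul' _ _ (ENNReal.inv_ne_top.2 (ne_of_gt (ENNReal.ofReal_pos.2 hM)))]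
  refine lintegral_mono fun x => ?_
  rw [← mul_assoc, ← lintegral_const_mul' _ _ (ENNReal.mul_ne_top (ENNReal.inv_ne_top.2 (ne_of_gt (ENNReal.ofReal_pos.2 hM)))
    (ENNReal.inv_ne_top.2 (ne_of_gt (ENNReal.ofReal_pos.2 (hw0 x)))))]
  refine lintegral_mono fun u => ?_
  by_cases hS : (x, u) ∈ {z : Ω × U | M * w z.1 < west z}
  · rw [Set.indicator_of_mem hS]
    have hlt : M * w x < west (x, u) := hS
    have hpos : 0 < west (x, u) := lt_trans (mul_pos hM (hw0 x)) hlt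
    -- `ŵ ≤ ŵ²/(M w)` on the region
    rw [← ENNReal.ofReal_inv_of_pos hM, ← ENNReal.ofReal_inv_of_pos (hw0 x), ← ENNReal.ofReal_mul (inv_nonneg.2 hM.le),
      ← ENNReal.ofReal_mul (mul_nonneg (inv_nonneg.2 hM.le) (inv_nonneg.2 (hw0 x).le))]
    refine ENNReal.ofReal_le_ofReal ?_
    rw [show M⁻¹ * (w x)⁻¹ * west (x, u) ^ 2 = west (x, u) * (west (x, u) / (M * w x)) by field_simp]
    have h1 : 1 ≤ west (x, u) / (M * w x) := (one_le_div (mul_pos hM (hw0 x))).2 hlt.le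
    calc west (x, u) = west (x, u) * 1 := (mul_one _).symm
      _ ≤ west (x, u) * (west (x, u) / (M * w x)) := mul_le_mul_of_nonneg_left h1 hpos.le
  · rw [Set.indicator_of_notMem hS]; exact bot_le

/-- **… I.E. AT MOST `M⁻¹·∫ (w + v/w) dq`** with `v` any measurable version of `x ↦ Var_κ ŵ(x, ·)` (square-integrable estimates, Bochner
unbiasedness): the `π`-weighted RELATIVE noise of the estimator controls the time lost to frozen overestimates. [ours] -/
theorem pseudoMarginal_overestimate_mass_le_var (hW : Measurable west) (hw : Measurable w) (hw0 : ∀ x, 0 < w x)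
    (hmem : ∀ x, MemLp (fun u => west (x, u)) 2 (κ x)) (hunb : ∀ x, ∫ u, west (x, u) ∂(κ x) = w x)
    {v : Ω → ℝ} (hv : ∀ x, variance (fun u => west (x, u)) (κ x) = v x) {M : ℝ} (hM : 0 < M) :
    ((q ⊗ₘ κ).withDensity fun z => ENNReal.ofReal (west z)) {z : Ω × U | M * w z.1 < west z} ≤
      (ENNReal.ofReal M)⁻¹ * ∫⁻ x, ENNReal.ofReal (w x + v x / w x) ∂q := by
  refine (pseudoMarginal_overestimate_mass_le hW hw hw0 hM).trans (mul_le_mul' le_rfl (lintegral_mono fun x => le_of_eq ?_))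
  have hint : Integrable (fun u => west (x, u) ^ 2) (κ x) := (hmem x).integrable_sq
  rw [← ofReal_integral_eq_lintegral_ofReal hint (ae_of_all _ fun u => sq_nonneg _), integral_sq_estimate_eq (hmem x) (hunb x), hv x,
    ← ENNReal.ofReal_inv_of_pos (hw0 x), ← ENNReal.ofReal_mul (inv_nonneg.2 (hw0 x).le)]
  congr 1
  field_simp

/-! ## The other direction: the noise costs at most its mean absolute deviation in `c₁` -/

omit [MeasurableSpace Ω] [MeasurableSpace U] in
/-- `min(1, b) − |a − b| ≤ min(1, a)`. [folklore] -/
theorem min_one_sub_abs_le (a b : ℝ) : min 1 b - |a - b| ≤ min 1 a := by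
  have h : |min 1 a - min 1 b| ≤ |a - b| :=
    (abs_min_sub_min_le_max 1 a 1 b).trans (by rw [sub_self, abs_zero, max_eq_right (abs_nonneg _)])
  have h2 := neg_abs_le (min 1 a - min 1 b)
  linarith

/-- Integrability of `min(1, f)` for integrable `f`. [ours, bookkeeping] -/
theorem integrable_min_one {α : Type*} [MeasurableSpace α] {ν : Measure α} [IsFiniteMeasure ν] {f : α → ℝ} (hf : Integrable f ν) :
    Integrable (fun z => min 1 (f z)) ν :=
  (hf.abs.add (integrable_const 1)).mono' (aestronglyMeasurable_const.inf hf.aestronglyMeasurable)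
    (ae_of_all _ fun z => by
      rw [Real.norm_eq_abs]
      calc |min 1 (f z)| ≤ max |(1 : ℝ)| |f z| := abs_min_le_max_abs_abs
        _ ≤ |f z| + 1 := by rw [abs_one]; exact max_le (by linarith [abs_nonneg (f z)]) (by linarith))

/-- **`ĉ₁ ≥ c₁ − E|ŵ − w|`**: with `PseudoMarginalFlowSampler`'s `ĉ₁ ≤ c₁` this brackets the noisy sampler's `c₁` — the input of every burn-in
and coupling rate of the tree — within the estimator's mean absolute deviation `E_{q⊗κ}|ŵ(x, u) − w(x)|` of the exact sampler's. [ours] -/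
theorem pseudoMarginal_integral_min_one_ge (hw : Measurable w) (hWi : Integrable west (q ⊗ₘ κ)) (hwi : Integrable w q) :
    ∫ x, min 1 (w x) ∂q - ∫ z, |west z - w z.1| ∂(q ⊗ₘ κ) ≤ ∫ z, min 1 (west z) ∂(q ⊗ₘ κ) := by
  -- `w ∘ fst` under `q ⊗ₘ κ` has the law of `w` under `q`
  have hfst : (q ⊗ₘ κ).map Prod.fst = q := Measure.fst_compProd q κ
  have hwi' : Integrable (fun z : Ω × U => w z.1) (q ⊗ₘ κ) :=
    (integrable_map_measure (by rw [hfst]; exact hw.aestronglyMeasurable) measurable_fst.aemeasurable).1 (by rwa [hfst])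
  have hmin_w : ∫ x, min 1 (w x) ∂q = ∫ z, min 1 (w z.1) ∂(q ⊗ₘ κ) := by
    have h := integral_map (μ := q ⊗ₘ κ) measurable_fst.aemeasurable (f := fun x => min 1 (w x))
      (by rw [hfst]; exact (measurable_const.min hw).aestronglyMeasurable)
    rw [hfst] at h
    exact h
  have hsub : Integrable (fun z : Ω × U => |west z - w z.1|) (q ⊗ₘ κ) := (hWi.sub hwi').abs
  rw [hmin_w, ← integral_sub (integrable_min_one hwi') hsub]
  exact integral_mono ((integrable_min_one hwi').sub hsub) (integrable_min_one hWi) fun z => min_one_sub_abs_le _ _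

/-! ## No every-start rate when the estimator is unbounded -/

/-- **AN UNBOUNDED ESTIMATOR KILLS EVERY EVERY-START RATE**: if the weight estimate takes arbitrarily large values (`∀ M, ∃ z, M ≤ ŵ(z)` —
Gaussian pseudofermion estimates do) and `Z = ∫ w dq < ∞`, then for every `t` and every `η > 0` there is a start `z` with `(δ_z K̂ᵗ)({z}) ≥ 1 − η`.
When `π̂` has no atom at `z` this is a total-variation distance `≥ 1 − η` after `t` steps: NO bound `sup_z ‖δ_z K̂ᵗ − π̂‖ ≤ Cρᵗ` with `ρ < 1` can
hold — the noisy sampler with an unbounded estimator is not uniformly ergodic (with a bounded one it is, `PseudoMarginalMultiProposal`). [ours] -/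
theorem pseudoMarginal_no_uniform_rate [MeasurableSingletonClass (Ω × U)] (hW : Measurable west) (hW0 : ∀ z, 0 < west z)
    (hunb : ∀ x, ∫⁻ u, ENNReal.ofReal (west (x, u)) ∂(κ x) = ENNReal.ofReal (w x))
    (hZ : ∫⁻ x, ENNReal.ofReal (w x) ∂q ≠ ⊤) (hlarge : ∀ M : ℝ, ∃ z : Ω × U, M ≤ west z) (t : ℕ) {η : ℝ} (hη : 0 < η) :
    haveI : Fact (Measurable west) := ⟨hW⟩
    ∃ z : Ω × U, ENNReal.ofReal (1 - η) ≤ ((fun μ : Measure (Ω × U) => μ.bind (indepMH (q ⊗ₘ κ) west))^[t] (Measure.dirac z)) {z} := by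
  haveI : Fact (Measurable west) := ⟨hW⟩
  set L : ℝ≥0∞ := ∫⁻ x, ENNReal.ofReal (w x) ∂q with hL
  set Z : ℝ := L.toReal with hZdef
  have hZ0 : 0 ≤ Z := ENNReal.toReal_nonneg
  -- a start whose estimate exceeds `M = Z + tZ/η + 1`
  obtain ⟨z, hz⟩ := hlarge (Z + t * Z / η + 1)
  have hM0 : 0 < Z + t * Z / η + 1 := by positivity
  have hzpos : 0 < west z := hW0 z
  set r : ℝ := Z / west z with hr
  have hr0 : 0 ≤ r := div_nonneg hZ0 hzpos.le
  have hr1 : r ≤ 1 := by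
    rw [hr, div_le_one hzpos]; linarith [show (0:ℝ) ≤ t * Z / η from by positivity]
  have htr : t * r ≤ η := by
    rw [hr, mul_div_assoc', div_le_iff₀ hzpos]
    have h1 : t * Z / η ≤ west z := by linarith
    have h2 : t * Z = (t * Z / η) * η := by field_simp
    rw [h2]
    exact mul_le_mul_of_nonneg_right h1 hη.le |>.trans_eq (mul_comm _ _)
  refine ⟨z, le_trans ?_ (pseudoMarginal_sojourn_ge hW hW0 hunb z t)⟩
  -- rewrite the `ℝ≥0∞` holding floor as `ofReal ((1 − r)^t)` and use Bernoulli
  have hLr : (ENNReal.ofReal (west z))⁻¹ * L = ENNReal.ofReal r := by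
    rw [← ENNReal.ofReal_toReal hZ, ← hZdef, ← ENNReal.ofReal_inv_of_pos hzpos, ← ENNReal.ofReal_mul (inv_nonneg.2 hzpos.le), hr,
      inv_mul_eq_div]
  rw [hLr, ← ENNReal.ofReal_one, ← ENNReal.ofReal_sub _ hr0, ← ENNReal.ofReal_pow (sub_nonneg.2 hr1)]
  refine ENNReal.ofReal_le_ofReal ?_
  have hB := one_add_mul_le_pow (show (-2 : ℝ) ≤ -r by linarith) t
  calc 1 - η ≤ 1 + t * (-r) := by linarith
    _ ≤ (1 + -r) ^ t := hB
    _ = (1 - r) ^ t := by ring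

end Summit.Ventures.LatticeQCDFlow.Exactness
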